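import Mathlib.Topology.MetricSpace.ProperSpace
import Literature.Geometry.Lorentzian.Basic
import Literature.Geometry.Lorentzian.CoordScalarCurvatureEvolution
import HarnessLib

/-!
# Crux `GapExhaustion` (stmt-FinalStateConjecture-10808), line `photon-shell-pseudoconvexity`:
# stub (C) `stub_hessMarginStable` — `C¹`-stability of a Hessian margin on null tangent vectors

Route `BartnikGapSettling`; helper (`--supports stmt-FinalStateConjecture-10808`) landing the
registered sub-stub (C) of `KerrCylindersBendInward` (line lead c6). Pure finite-dimensional
analysis over the coordinate tensor calculus of
`Literature/Geometry/Lorentzian/CoordCurvature.lean` (`sharpAt`, `koszulOp`, `chrAt`) and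
`CoordScalarCurvatureEvolution.lean` (`hessAt`): the coordinate Hessian
`hessAt G f x w w = D²f(x)(w,w) − Df(x)(½ (G x)⁻¹ (koszulOp (DG(x)) w w))` depends only on the
jet `(G x, DG(x), Df(x), D²f(x))` and is continuous in it wherever `G x` is invertible
(`ContinuousLinearMap.IsInvertible.contDiffAt_map_inverse`). Hence a margin
`hessAt G₀ f x w w ≤ −2μ‖w‖²` on the `G₀`-null vectors tangent to the level sets of `f`, over a
compact set `S` on a neighbourhood of which `G₀` is `C¹` and `f` is `C²`, survives as
`≤ −μ‖w‖²` for all components `G` whose 1-jet at the point is `δ`-close to that of `G₀`.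

Proof: by homogeneity reduce to unit vectors; the set of "good" jet perturbations is a
neighbourhood of `(S × sphere) × {0}` (continuity of the jet functional and of the two
constraints), and the generalised tube lemma (`IsCompact.mem_nhdsSet_prod_of_forall`) gives a
uniform `δ`.
-/

noncomputable section

-- instance search through the nested operator types `E4 →L[ℝ] E4 →L[ℝ] E4 →L[ℝ] ℝ`
set_option maxSynthPendingDepth 3

-- D-0017: single-problem summit, `Summit.<S>.<S>.…` by design (cf. lakefile `weak.linter.dupNamespace`).
set_option linter.dupNamespace false

namespace Summit.FinalStateConjecture.FinalStateConjecture.Theorems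

open Set Filter
open Literature.Geometry.Lorentzian Literature.Geometry.Lorentzian.MetricCoord
open scoped Topology

/-- Generalised tube lemma in the form used below: a property of `(z, p)` holding near
`(z, 0)` for every `z` in a compact set `K` holds for all `z ∈ K` and all `‖p‖ ≤ δ`, for some
uniform `δ > 0`. [folklore] -/
private theorem hessMarginStable_tube {X P : Type*} [TopologicalSpace X]
    [SeminormedAddCommGroup P] {K : Set X} (hK : IsCompact K) {good : X × P → Prop}
    (h : ∀ z ∈ K, ∀ᶠ q in 𝓝 (z, (0 : P)), good q) :
    ∃ δ : ℝ, 0 < δ ∧ ∀ z ∈ K, ∀ p : P, ‖p‖ ≤ δ → good (z, p) := by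
  have hmem : {q | good q} ∈ (𝓝ˢ K) ×ˢ 𝓝 (0 : P) :=
    hK.mem_nhdsSet_prod_of_forall fun z hz => by rw [← nhds_prod_eq]; exact h z hz
  obtain ⟨A, hA, B, hB, hAB⟩ := Filter.mem_prod_iff.1 hmem
  obtain ⟨ε, hε, hεB⟩ := Metric.mem_nhds_iff.1 hB
  refine ⟨ε / 2, half_pos hε, fun z hz p hp =>
    hAB (mk_mem_prod (subset_of_mem_nhdsSet hA hz) ?_)⟩
  exact hεB (mem_ball_zero_iff.2 (hp.trans_lt (half_lt_self hε)))

/-- The local step: at a point `x` of the open set `U` (where `G₀` is `C¹`, `f` is `C²` and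
`G₀ x` is invertible) and a direction `v` at which the strict margin holds whenever `v` is
`G₀ x`-null and tangent to the level set of `f`, the implication
"null and tangent ⇒ jet functional `≤ -μ`" holds for all nearby points, directions and all
small perturbations `(p.2.1, p.2.2)` of the 1-jet `(G₀, DG₀)`. [folklore] -/
private theorem hessMarginStable_eventually
    {G₀ : E4 → E4 →L[ℝ] E4 →L[ℝ] ℝ} {f : E4 → ℝ} {U : Set E4} {μ : ℝ} (hU : IsOpen U)
    (hG₀ : ContDiffOn ℝ 1 G₀ U) (hf : ContDiffOn ℝ 2 f U) {x : E4} (hx : x ∈ U)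
    (hi : (G₀ x).IsInvertible) (v : E4)
    (hxv : G₀ x v v = 0 → fderiv ℝ f x v = 0 → hessAt G₀ f x v v < -μ) :
    ∀ᶠ p in 𝓝 (((x, v), 0) :
        (E4 × E4) × ((E4 →L[ℝ] E4 →L[ℝ] ℝ) × (E4 →L[ℝ] E4 →L[ℝ] E4 →L[ℝ] ℝ))),
      (G₀ p.1.1 + p.2.1) p.1.2 p.1.2 = 0 → fderiv ℝ f p.1.1 p.1.2 = 0 →
      fderiv ℝ (fderiv ℝ f) p.1.1 p.1.2 p.1.2 - fderiv ℝ f p.1.1 ((2⁻¹ : ℝ) •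
        (G₀ p.1.1 + p.2.1).inverse (koszulOp (fderiv ℝ G₀ p.1.1 + p.2.2) p.1.2 p.1.2)) ≤ -μ := by
  have hxU : U ∈ 𝓝 x := hU.mem_nhds hx
  -- continuity of the jets of `G₀` and `f` at `x`
  have hcG : ContinuousAt G₀ x := hG₀.continuousOn.continuousAt hxU
  have hcdG : ContinuousAt (fderiv ℝ G₀) x :=
    (hG₀.continuousOn_fderiv_of_isOpen hU le_rfl).continuousAt hxU
  have hcdf : ContinuousAt (fderiv ℝ f) x :=
    (hf.continuousOn_fderiv_of_isOpen hU (by norm_num)).continuousAt hxU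
  have hcddf : ContinuousAt (fderiv ℝ (fderiv ℝ f)) x :=
    ((hf.fderiv_of_isOpen hU (m := 1) (by norm_num)).continuousOn_fderiv_of_isOpen hU
      le_rfl).continuousAt hxU
  -- the coordinate projections of the parameter space
  have h11 : Continuous fun p : (E4 × E4) × ((E4 →L[ℝ] E4 →L[ℝ] ℝ) ×
      (E4 →L[ℝ] E4 →L[ℝ] E4 →L[ℝ] ℝ)) => p.1.1 := continuous_fst.comp continuous_fst
  have h12 : Continuous fun p : (E4 × E4) × ((E4 →L[ℝ] E4 →L[ℝ] ℝ) ×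
      (E4 →L[ℝ] E4 →L[ℝ] E4 →L[ℝ] ℝ)) => p.1.2 := continuous_snd.comp continuous_fst
  have h21 : Continuous fun p : (E4 × E4) × ((E4 →L[ℝ] E4 →L[ℝ] ℝ) ×
      (E4 →L[ℝ] E4 →L[ℝ] E4 →L[ℝ] ℝ)) => p.2.1 := continuous_fst.comp continuous_snd
  have h22 : Continuous fun p : (E4 × E4) × ((E4 →L[ℝ] E4 →L[ℝ] ℝ) ×
      (E4 →L[ℝ] E4 →L[ℝ] E4 →L[ℝ] ℝ)) => p.2.2 := continuous_snd.comp continuous_snd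
  -- continuity of the pieces of the jet functional at `p₀ = ((x, v), 0)`
  have hA : ContinuousAt (fun p : (E4 × E4) × ((E4 →L[ℝ] E4 →L[ℝ] ℝ) ×
      (E4 →L[ℝ] E4 →L[ℝ] E4 →L[ℝ] ℝ)) => G₀ p.1.1 + p.2.1) ((x, v), 0) :=
    (hcG.comp h11.continuousAt).add h21.continuousAt
  have hB : ContinuousAt (fun p : (E4 × E4) × ((E4 →L[ℝ] E4 →L[ℝ] ℝ) ×
      (E4 →L[ℝ] E4 →L[ℝ] E4 →L[ℝ] ℝ)) => fderiv ℝ f p.1.1) ((x, v), 0) :=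
    hcdf.comp h11.continuousAt
  have hC : ContinuousAt (fun p : (E4 × E4) × ((E4 →L[ℝ] E4 →L[ℝ] ℝ) ×
      (E4 →L[ℝ] E4 →L[ℝ] E4 →L[ℝ] ℝ)) => fderiv ℝ (fderiv ℝ f) p.1.1 p.1.2 p.1.2) ((x, v), 0) :=
    ((hcddf.comp h11.continuousAt).clm_apply h12.continuousAt).clm_apply h12.continuousAt
  have hD : ContinuousAt (fun p : (E4 × E4) × ((E4 →L[ℝ] E4 →L[ℝ] ℝ) ×
      (E4 →L[ℝ] E4 →L[ℝ] E4 →L[ℝ] ℝ)) => (G₀ p.1.1 + p.2.1).inverse) ((x, v), 0) := by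
    refine ContinuousAt.comp_of_eq (hi.contDiffAt_map_inverse (n := 0)).continuousAt hA ?_
    simp
  have hE : ContinuousAt (fun p : (E4 × E4) × ((E4 →L[ℝ] E4 →L[ℝ] ℝ) ×
      (E4 →L[ℝ] E4 →L[ℝ] E4 →L[ℝ] ℝ)) =>
        koszulOp (fderiv ℝ G₀ p.1.1 + p.2.2) p.1.2 p.1.2) ((x, v), 0) :=
    ((koszulOp.continuous.continuousAt.comp
      ((hcdG.comp h11.continuousAt).add h22.continuousAt)).clm_apply
        h12.continuousAt).clm_apply h12.continuousAt
  have hΦ : ContinuousAt (fun p : (E4 × E4) × ((E4 →L[ℝ] E4 →L[ℝ] ℝ) ×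
      (E4 →L[ℝ] E4 →L[ℝ] E4 →L[ℝ] ℝ)) =>
      fderiv ℝ (fderiv ℝ f) p.1.1 p.1.2 p.1.2 - fderiv ℝ f p.1.1 ((2⁻¹ : ℝ) •
        (G₀ p.1.1 + p.2.1).inverse (koszulOp (fderiv ℝ G₀ p.1.1 + p.2.2) p.1.2 p.1.2)))
      ((x, v), 0) :=
    hC.sub (hB.clm_apply ((hD.clm_apply hE).const_smul (2⁻¹ : ℝ)))
  have hα : ContinuousAt (fun p : (E4 × E4) × ((E4 →L[ℝ] E4 →L[ℝ] ℝ) ×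
      (E4 →L[ℝ] E4 →L[ℝ] E4 →L[ℝ] ℝ)) => (G₀ p.1.1 + p.2.1) p.1.2 p.1.2) ((x, v), 0) :=
    (hA.clm_apply h12.continuousAt).clm_apply h12.continuousAt
  have hβ : ContinuousAt (fun p : (E4 × E4) × ((E4 →L[ℝ] E4 →L[ℝ] ℝ) ×
      (E4 →L[ℝ] E4 →L[ℝ] E4 →L[ℝ] ℝ)) => fderiv ℝ f p.1.1 p.1.2) ((x, v), 0) :=
    hB.clm_apply h12.continuousAt
  by_cases h0 : G₀ x v v = 0 ∧ fderiv ℝ f x v = 0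
  · -- strict margin at `p₀`, hence `< -μ` nearby
    have hlt : fderiv ℝ (fderiv ℝ f) x v v - fderiv ℝ f x ((2⁻¹ : ℝ) •
        (G₀ x + 0).inverse (koszulOp (fderiv ℝ G₀ x + 0) v v)) < -μ := by
      rw [add_zero, add_zero]
      have h := hxv h0.1 h0.2
      rwa [hessAt_apply, chrAt_apply] at h
    filter_upwards [hΦ.eventually_lt continuousAt_const hlt] with p hp _ _ using hp.le
  · -- one of the two constraints fails at `p₀`, hence nearby
    rcases not_and_or.1 h0 with h1 | h2
    · have h1' : (G₀ x + 0) v v ≠ 0 := by rwa [add_zero]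
      filter_upwards [hα.eventually_ne h1'] with p hp hp1 _ using absurd hp1 hp
    · filter_upwards [hβ.eventually_ne h2] with p hp _ hp2 using absurd hp2 hp

/-- **Stub (C) of `KerrCylindersBendInward` (line `photon-shell-pseudoconvexity`, crux
`GapExhaustion`, stmt-FinalStateConjecture-10808) — `C¹`-stability of a Hessian margin on null
tangent vectors.** Let `G₀` be `C¹` and `f` be `C²` on an open neighbourhood of the compact set
`S ⊆ E4`, with `G₀ x` invertible on `S`, and suppose the coordinate Hessian satisfies
`hessAt G₀ f x w w ≤ -2μ‖w‖²` for all `x ∈ S` and all `w` with `G₀ x w w = 0`, `Df(x) w = 0`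
(`μ > 0`). Then there is `δ > 0` such that for every `x ∈ S` and every field of components `G`
with `‖G x - G₀ x‖ ≤ δ` and `‖DG(x) - DG₀(x)‖ ≤ δ`, `hessAt G f x w w ≤ -μ‖w‖²` for all `w` with
`G x w w = 0`, `Df(x) w = 0`. Compactness of `S × sphere` and continuity of the jet functional
(inversion of continuous linear maps is continuous at invertible maps). [folklore] -/
theorem stub_hessMarginStable :
    ∀ (G₀ : E4 → E4 →L[ℝ] E4 →L[ℝ] ℝ) (f : E4 → ℝ) (S : Set E4) (μ : ℝ), IsCompact S → 0 < μ →
    (∃ U : Set E4, IsOpen U ∧ S ⊆ U ∧ ContDiffOn ℝ 1 G₀ U ∧ ContDiffOn ℝ 2 f U) →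
    (∀ x ∈ S, (G₀ x).IsInvertible) →
    (∀ x ∈ S, ∀ w : E4, G₀ x w w = 0 → fderiv ℝ f x w = 0 →
      hessAt G₀ f x w w ≤ -(2 * μ) * ‖w‖ ^ 2) →
    ∃ δ : ℝ, 0 < δ ∧ ∀ x ∈ S, ∀ G : E4 → E4 →L[ℝ] E4 →L[ℝ] ℝ,
      ‖G x - G₀ x‖ ≤ δ → ‖fderiv ℝ G x - fderiv ℝ G₀ x‖ ≤ δ →
      ∀ w : E4, G x w w = 0 → fderiv ℝ f x w = 0 → hessAt G f x w w ≤ -μ * ‖w‖ ^ 2 := by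
  intro G₀ f S μ hS hμ hU hinv hmargin
  obtain ⟨U, hU, hSU, hG₀, hf⟩ := hU
  -- the "good" implication holds near `(z, 0)` for every `z ∈ S × sphere`
  have hnhds : ∀ z ∈ S ×ˢ Metric.sphere (0 : E4) 1,
      ∀ᶠ p in 𝓝 ((z, 0) :
        (E4 × E4) × ((E4 →L[ℝ] E4 →L[ℝ] ℝ) × (E4 →L[ℝ] E4 →L[ℝ] E4 →L[ℝ] ℝ))),
      (G₀ p.1.1 + p.2.1) p.1.2 p.1.2 = 0 → fderiv ℝ f p.1.1 p.1.2 = 0 →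
      fderiv ℝ (fderiv ℝ f) p.1.1 p.1.2 p.1.2 - fderiv ℝ f p.1.1 ((2⁻¹ : ℝ) •
        (G₀ p.1.1 + p.2.1).inverse (koszulOp (fderiv ℝ G₀ p.1.1 + p.2.2) p.1.2 p.1.2))
        ≤ -μ := by
    rintro ⟨x, v⟩ ⟨hx, hv⟩
    refine hessMarginStable_eventually hU hG₀ hf (hSU hx) (hinv x hx) v fun h1 h2 => ?_
    have h := hmargin x hx v h1 h2
    rw [mem_sphere_zero_iff_norm.1 hv] at h
    linarith
  obtain ⟨δ, hδ, hgood⟩ := hessMarginStable_tube (hS.prod (isCompact_sphere (0 : E4) 1)) hnhds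
  refine ⟨δ, hδ, fun x hx G hG hdG w hGw hfw => ?_⟩
  by_cases hw : w = 0
  · subst hw
    simp
  -- normalise `w` and apply the tube at the jet perturbation `(G x - G₀ x, DG(x) - DG₀(x))`
  have hn : 0 < ‖w‖ := norm_pos_iff.2 hw
  have hv1 : ‖‖w‖⁻¹ • w‖ = 1 := by
    rw [norm_smul, norm_inv, norm_norm, inv_mul_cancel₀ hn.ne']
  have key : (G₀ x + (G x - G₀ x)) (‖w‖⁻¹ • w) (‖w‖⁻¹ • w) = 0 →
      fderiv ℝ f x (‖w‖⁻¹ • w) = 0 →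
      fderiv ℝ (fderiv ℝ f) x (‖w‖⁻¹ • w) (‖w‖⁻¹ • w) - fderiv ℝ f x ((2⁻¹ : ℝ) •
        (G₀ x + (G x - G₀ x)).inverse (koszulOp (fderiv ℝ G₀ x + (fderiv ℝ G x - fderiv ℝ G₀ x))
          (‖w‖⁻¹ • w) (‖w‖⁻¹ • w))) ≤ -μ :=
    hgood (x, ‖w‖⁻¹ • w) (mk_mem_prod hx (mem_sphere_zero_iff_norm.2 hv1))
      (G x - G₀ x, fderiv ℝ G x - fderiv ℝ G₀ x) (max_le hG hdG)
  rw [add_sub_cancel, add_sub_cancel] at key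
  have h1 : G x (‖w‖⁻¹ • w) (‖w‖⁻¹ • w) = 0 := by
    simp only [map_smul, _root_.smul_apply, hGw, smul_eq_mul, mul_zero]
  have h2 : fderiv ℝ f x (‖w‖⁻¹ • w) = 0 := by
    simp only [map_smul, hfw, smul_eq_mul, mul_zero]
  have h3 : hessAt G f x (‖w‖⁻¹ • w) (‖w‖⁻¹ • w) ≤ -μ := by
    rw [hessAt_apply, chrAt_apply]
    exact key h1 h2
  have h4 : hessAt G f x (‖w‖⁻¹ • w) (‖w‖⁻¹ • w) = ‖w‖⁻¹ * (‖w‖⁻¹ * hessAt G f x w w) := by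
    simp only [map_smul, _root_.smul_apply, smul_eq_mul]
  have h5 : hessAt G f x w w = ‖w‖ ^ 2 * hessAt G f x (‖w‖⁻¹ • w) (‖w‖⁻¹ • w) := by
    rw [h4]
    field_simp
  calc hessAt G f x w w = ‖w‖ ^ 2 * hessAt G f x (‖w‖⁻¹ • w) (‖w‖⁻¹ • w) := h5
    _ ≤ ‖w‖ ^ 2 * (-μ) := by gcongr
    _ = -μ * ‖w‖ ^ 2 := by ring

end Summit.FinalStateConjecture.FinalStateConjecture.Theorems

end
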